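import Summits.HubbardSuperconductivity.HubbardSuperconductivity.Theorems.AnisotropyChordFourTorusKernelCertY

/-!
# Route `AnisotropyChord` / crux `ChordXY` at `M = 4`: kernel decisions for certificate matrices Y5, Y6
# (prover seat `hubbard-h0-rotor-p1` g18)
-/

set_option linter.style.longLine false
set_option linter.dupNamespace false
set_option autoImplicit false

namespace Summit.HubbardSuperconductivity.HubbardSuperconductivity.Theorems.AnisotropyChord.FourTorus

/-- certificate `Y5`: residual diagonally dominant, rows `< 29`. [folklore] -/
theorem certDomY_5_lo : certDomY 5 0 = true := by decide +kernel
/-- certificate `Y5`: residual diagonally dominant, rows `≥ 29`. [folklore] -/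
theorem certDomY_5_hi : certDomY 5 1 = true := by decide +kernel
/-- certificate `Y5`: the matrix is symmetric. [folklore] -/
theorem certSymY_5 : certSymY 5 = true := by decide +kernel
/-- certificate `Y6`: residual diagonally dominant, rows `< 29`. [folklore] -/
theorem certDomY_6_lo : certDomY 6 0 = true := by decide +kernel
/-- certificate `Y6`: residual diagonally dominant, rows `≥ 29`. [folklore] -/
theorem certDomY_6_hi : certDomY 6 1 = true := by decide +kernel
/-- certificate `Y6`: the matrix is symmetric. [folklore] -/
theorem certSymY_6 : certSymY 6 = true := by decide +kernel

end Summit.HubbardSuperconductivity.HubbardSuperconductivity.Theorems.AnisotropyChord.FourTorus
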